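import Summits.KontsevichZagierPeriods.KontsevichZagierPeriods.Theorems.GpcZeta4Eq4zeta31.Negative.InvScissors
import Summits.KontsevichZagierPeriods.KontsevichZagierPeriods.Theorems.GpcZeta4Eq4zeta31.Negative.PermScissors
import Summits.KontsevichZagierPeriods.KontsevichZagierPeriods.Theorems.GpcZeta4Eq4zeta31.Negative.Gap

/-!
# `GpcZeta4Eq4zeta31` (stmt-KontsevichZagierPeriods-0275): negative side — the corner invariant:
# shuffles, dualities and reflections together do not prove `ζ(4) = 4ζ(3,1)`

Companion of `InvScissors.lean` and `PermScissors.lean` (cdisprove unit, route `Grothendieck`). With the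
corner pattern `U = cornerWin` (`δ = 10⁻⁶`, `δ' = 9·10⁻⁷`): `∫_{Δ₄ ∩ U} (ω₀₀₀₁ − 4ω₀₀₁₁) > 0`
(`windowEval_corner_target_pos`) — on the all-low chamber (`t₀ < 1/2`, so every coordinate is in
`(δ', δ)`) the gap is nonnegative and `≥ 999·10¹⁵` on a sub-box of volume `(1/4·10⁷)⁴`; on the chambers
with `t₀` near `1` it is `≥ −4ω₀₀₁₁ ≥ −5·10¹²` (two cases on `t₁`) on a set of volume `≤ (2·10⁻⁷)⁴`.
Hence `target_not_mem_invScissors_corner` and, since coordinate permutations and reflections preserve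
`U`, **`target_not_mem_hyperScissors`: the closure of dissections, integrand additivity, coordinate
permutations and reflections `tᵢ ↦ 1 − tᵢ` — containing the shuffle toolkit, MZV duality and the toric
flips; a genuine sub-calculus of `KZ.relations` (`hyperScissors_le_relations`) — does not contain the
target.** Any proof of the crux inside the calculus uses a change of variables outside the
hyperoctahedral group (Eie's rational substitution of line (β); the cubical monomial map of the stuffle)
or a Newton–Leibniz move.
Sources: M. Kontsevich, D. Zagier, *Periods* (2001), §1.2 rules (1), (2). -/

noncomputable section

namespace Summit.KontsevichZagierPeriods.GpcZeta4Eq4zeta31.Negative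

open Set MeasureTheory
open Literature.NumberTheory.Transcendental
open Literature.NumberTheory.Transcendental.KZ
open Summit.KontsevichZagierPeriods.KontsevichZagierPeriods.Theses.Grothendieck (GpcZeta4Eq4zeta31)
open Summit.KontsevichZagierPeriods.MzvKernelInKZ.Negative
open Summit.KontsevichZagierPeriods.HoffmanRelationInKZ.Negative
  (window window_eq_pi isOpen_window measurableSet_window windowEval windowEval_of addOnly
    addOnly_le_ker_windowEval setIntegral_pos_of_pos_on)

/-! ## §1 The corner invariant is positive on the target -/

section Positivity
/-- The test set `S = Δ₄ ∩ U`, split at `t₀ = 1/2`. -/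
def Sall : Set (Fin 4 → ℝ) := simplex 4 ∩ cornerWin 4
/-- The all-low part (`t₀ < 1/2`, hence every coordinate in `(δ', δ)`). -/
def Slo : Set (Fin 4 → ℝ) := Sall ∩ {x | x 0 < 1 / 2}
/-- The part with `t₀` near `1`. -/
def Shi : Set (Fin 4 → ℝ) := Sall ∩ {x | 1 / 2 ≤ x 0}

/-- `S` is measurable. [folklore] -/
theorem measurableSet_Sall : MeasurableSet Sall :=
  (KZ.measurableSet_openOrderedSimplex 4).inter (measurableSet_cornerWin 4)

/-- The all-low part is measurable. [folklore] -/
theorem measurableSet_Slo : MeasurableSet Slo :=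
  measurableSet_Sall.inter (measurableSet_lt (measurable_pi_apply 0) measurable_const)

/-- The high part is measurable. [folklore] -/
theorem measurableSet_Shi : MeasurableSet Shi :=
  measurableSet_Sall.inter (measurableSet_le measurable_const (measurable_pi_apply 0))

/-- `S` is the union of its two parts. [folklore] -/
theorem Sall_eq_union : Sall = Slo ∪ Shi := by
  ext x
  simp only [Slo, Shi, mem_union, mem_inter_iff, mem_setOf_eq]
  constructor
  · intro hx
    rcases lt_or_ge (x 0) (1 / 2) with h | h
    · exact Or.inl ⟨hx, h⟩
    · exact Or.inr ⟨hx, h⟩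
  · rintro (⟨hx, _⟩ | ⟨hx, _⟩) <;> exact hx

/-- The two parts are disjoint. [folklore] -/
theorem disjoint_Slo_Shi : Disjoint Slo Shi := by
  rw [Set.disjoint_left]
  rintro x ⟨_, h1⟩ ⟨_, h2⟩
  simp only [mem_setOf_eq] at h1 h2
  linarith

/-- On the all-low part every coordinate lies in `(δ', δ)`. [folklore] -/
theorem coord_mem_Ioo_of_mem_Slo {x : Fin 4 → ℝ} (hx : x ∈ Slo) (i : Fin 4) : δ' < x i ∧ x i < δ := by
  obtain ⟨⟨hsx, hU⟩, h0⟩ := hx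
  simp only [mem_setOf_eq] at h0
  have hδ : δ = 1 / 1000000 := δ_eq
  have hδ' : δ' = 9 / 10000000 := δ'_eq
  have hx0 : x 0 < δ := by
    rcases hU 0 with ⟨_, h⟩ | ⟨h, _⟩
    · exact h
    · exfalso; linarith
  have hle : x i ≤ x 0 := hsx.2.2.antitone (Fin.zero_le i)
  rcases hU i with ⟨h1, h2⟩ | ⟨h1, _⟩
  · exact ⟨h1, h2⟩
  · exfalso; linarith

/-- `h ≥ 0` on the all-low part (`t₂ < δ < 1/5`). [folklore] -/
theorem hgap_nonneg_of_mem_Slo {x : Fin 4 → ℝ} (hx : x ∈ Slo) : 0 ≤ hgap x := by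
  have hδ : δ = 1 / 1000000 := δ_eq
  have hδ' : δ' = 9 / 10000000 := δ'_eq
  have c0 := coord_mem_Ioo_of_mem_Slo hx 0
  have c1 := coord_mem_Ioo_of_mem_Slo hx 1
  have c2 := coord_mem_Ioo_of_mem_Slo hx 2
  have c3 := coord_mem_Ioo_of_mem_Slo hx 3
  exact (hgap_pos (by linarith) (by linarith) (by linarith) (by linarith) (by linarith)).le

/-- Lower bound of `h` on the all-low part: `h ≥ (1/δ)²·(1/δ − 4/(1−δ)) ≥ 999·10¹⁵`. [folklore] -/
theorem hgap_ge_of_mem_Slo {x : Fin 4 → ℝ} (hx : x ∈ Slo) : (999000000000000000 : ℝ) ≤ hgap x := by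
  have hδ : δ = 1 / 1000000 := δ_eq
  have hδ' : δ' = 9 / 10000000 := δ'_eq
  obtain ⟨a0, b0⟩ := coord_mem_Ioo_of_mem_Slo hx 0
  obtain ⟨a1, b1⟩ := coord_mem_Ioo_of_mem_Slo hx 1
  obtain ⟨a2, b2⟩ := coord_mem_Ioo_of_mem_Slo hx 2
  obtain ⟨a3, b3⟩ := coord_mem_Ioo_of_mem_Slo hx 3
  rw [hδ] at b0 b1 b2 b3
  rw [hδ'] at a0 a1 a2 a3
  have p0 : 0 < x 0 := by linarith
  have p1 : 0 < x 1 := by linarith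
  have p2 : 0 < x 2 := by linarith
  have p3 : 0 < 1 - x 3 := by linarith
  have hA : (1000000 : ℝ) ≤ (x 0)⁻¹ := by
    rw [le_inv_comm₀ (by norm_num) p0]; linarith
  have hB : (1000000 : ℝ) ≤ (x 1)⁻¹ := by
    rw [le_inv_comm₀ (by norm_num) p1]; linarith
  have hC : (1 : ℝ) ≤ (1 - x 3)⁻¹ := by
    rw [le_inv_comm₀ (by norm_num) p3]; simp only [inv_one]; linarith
  have hD1 : (1000000 : ℝ) ≤ (x 2)⁻¹ := by
    rw [le_inv_comm₀ (by norm_num) p2]; linarith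
  have hD2 : 4 * (1 - x 2)⁻¹ ≤ (5 : ℝ) := by
    rw [← div_eq_mul_inv, div_le_iff₀ (by linarith)]; linarith
  have hD : (999000 : ℝ) ≤ (x 2)⁻¹ - 4 * (1 - x 2)⁻¹ := by linarith
  rw [hgap_eq]
  have hAB : (1000000 : ℝ) * 1000000 ≤ (x 0)⁻¹ * (x 1)⁻¹ :=
    mul_le_mul hA hB (by norm_num) (le_trans (by norm_num) hA)
  have hABC : (1000000 : ℝ) * 1000000 * 1 ≤ (x 0)⁻¹ * (x 1)⁻¹ * (1 - x 3)⁻¹ :=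
    mul_le_mul hAB hC (by norm_num) (le_trans (by norm_num) hAB)
  calc (999000000000000000 : ℝ) = 1000000 * 1000000 * 1 * 999000 := by norm_num
    _ ≤ (x 0)⁻¹ * (x 1)⁻¹ * (1 - x 3)⁻¹ * ((x 2)⁻¹ - 4 * (1 - x 2)⁻¹) :=
        mul_le_mul hABC hD (by norm_num) (le_trans (by norm_num) hABC)

/-- Upper bound of `4ω₀₀₁₁` on the part with `t₀` near `1`: `≤ 4/((1−δ)²δ'²) ≤ 5·10¹²`. [folklore] -/
theorem four_omega31_le_of_mem_Shi {x : Fin 4 → ℝ} (hx : x ∈ Shi) : wordFun ω31 4 x ≤ (5000000000000 : ℝ) := by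
  have hδ : δ = 1 / 1000000 := δ_eq
  have hδ' : δ' = 9 / 10000000 := δ'_eq
  obtain ⟨⟨hsx, hU⟩, h0⟩ := hx
  simp only [mem_setOf_eq] at h0
  obtain ⟨hpos, hlt1, hanti⟩ := hsx
  rw [wordFun_ω31_inv]
  push_cast
  have hU' : ∀ i, (9 / 10000000 : ℝ) < x i ∧ x i < 1 / 1000000 ∨ 1 - 1 / 1000000 < x i ∧ x i < 1 - 9 / 10000000 := by
    intro i
    have := hU i
    simp only [nearEnds, mem_union, mem_Ioo, hδ, hδ'] at this
    exact this
  -- bounds valid in all cases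
  have hx0 : 1 - 1 / 1000000 < x 0 := by
    rcases hU' 0 with ⟨_, h⟩ | ⟨h, _⟩
    · exfalso; linarith
    · exact h
  have i0 : (x 0)⁻¹ ≤ (1 - 1 / 1000000 : ℝ)⁻¹ := inv_anti₀ (by norm_num) hx0.le
  have t2lt : x 2 < 1 - 9 / 10000000 := by
    rcases hU' 2 with ⟨_, h⟩ | ⟨_, h⟩
    · linarith
    · exact h
  have t3lt : x 3 < 1 - 9 / 10000000 := by
    rcases hU' 3 with ⟨_, h⟩ | ⟨_, h⟩
    · linarith
    · exact h
  have n0 : 0 ≤ (x 0)⁻¹ := inv_nonneg.2 (hpos 0).le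
  have n1 : 0 ≤ (x 1)⁻¹ := inv_nonneg.2 (hpos 1).le
  have n2 : 0 ≤ (1 - x 2)⁻¹ := inv_nonneg.2 (by linarith [hlt1 2])
  have n3 : 0 ≤ (1 - x 3)⁻¹ := inv_nonneg.2 (by linarith [hlt1 3])
  rcases hU' 1 with ⟨a1, b1⟩ | ⟨a1, b1⟩
  · -- x₁ low ⇒ x₂, x₃ low
    have x2lt : x 2 < 1 / 1000000 := lt_trans (hanti (by decide : (1 : Fin 4) < 2)) b1
    have x3lt : x 3 < 1 / 1000000 := lt_trans (hanti (by decide : (1 : Fin 4) < 3)) b1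
    have i1 : (x 1)⁻¹ ≤ (9 / 10000000 : ℝ)⁻¹ := inv_anti₀ (by norm_num) a1.le
    have i2 : (1 - x 2)⁻¹ ≤ (1 - 1 / 1000000 : ℝ)⁻¹ := inv_anti₀ (by norm_num) (by linarith)
    have i3 : (1 - x 3)⁻¹ ≤ (1 - 1 / 1000000 : ℝ)⁻¹ := inv_anti₀ (by norm_num) (by linarith)
    calc (4 : ℝ) * ((x 0)⁻¹ * (x 1)⁻¹ * (1 - x 2)⁻¹ * (1 - x 3)⁻¹)
        ≤ 4 * ((1 - 1 / 1000000 : ℝ)⁻¹ * (9 / 10000000 : ℝ)⁻¹ * (1 - 1 / 1000000 : ℝ)⁻¹ *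
            (1 - 1 / 1000000 : ℝ)⁻¹) := by gcongr
      _ ≤ 5000000000000 := by norm_num
  · have i1 : (x 1)⁻¹ ≤ (1 - 1 / 1000000 : ℝ)⁻¹ := inv_anti₀ (by norm_num) a1.le
    have i2 : (1 - x 2)⁻¹ ≤ (9 / 10000000 : ℝ)⁻¹ := inv_anti₀ (by norm_num) (by linarith)
    have i3 : (1 - x 3)⁻¹ ≤ (9 / 10000000 : ℝ)⁻¹ := inv_anti₀ (by norm_num) (by linarith)
    calc (4 : ℝ) * ((x 0)⁻¹ * (x 1)⁻¹ * (1 - x 2)⁻¹ * (1 - x 3)⁻¹)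
        ≤ 4 * ((1 - 1 / 1000000 : ℝ)⁻¹ * (1 - 1 / 1000000 : ℝ)⁻¹ * (9 / 10000000 : ℝ)⁻¹ *
            (9 / 10000000 : ℝ)⁻¹) := by gcongr
      _ ≤ 5000000000000 := by norm_num

/-- Hence `h ≥ −5·10¹²` on that part (`ω₀₀₀₁ > 0`). [folklore] -/
theorem hgap_ge_of_mem_Shi {x : Fin 4 → ℝ} (hx : x ∈ Shi) : (-5000000000000 : ℝ) ≤ hgap x := by
  have h4 := four_omega31_le_of_mem_Shi hx
  obtain ⟨⟨⟨hpos, hlt1, _⟩, _⟩, _⟩ := hx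
  have hw4 : 0 ≤ wordFun ω4 1 x := by
    rw [wordFun_ω4_one_inv]
    have : 0 < 1 - x 3 := by linarith [hlt1 3]
    have := hpos 0; have := hpos 1; have := hpos 2
    positivity
  rw [hgap]
  linarith

/-- Lower corners of the sub-box `(39,38,37,36)/4·10⁷ < t < (40,39,38,37)/4·10⁷` of the all-low part. -/
def loS : ℕ → ℝ := fun i => (([39/40000000, 38/40000000, 37/40000000, 36/40000000] : List ℚ).getD i 0 : ℚ)
/-- Upper corners of the sub-box. -/
def hiS : ℕ → ℝ := fun i => (([40/40000000, 39/40000000, 38/40000000, 37/40000000] : List ℚ).getD i 0 : ℚ)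

/-- Coordinates of a point of the sub-box. [folklore] -/
theorem mem_windowS {t : Fin 4 → ℝ} (ht : t ∈ window loS hiS 4) :
    39/40000000 < t 0 ∧ t 0 < 1/1000000 ∧ 19/20000000 < t 1 ∧ t 1 < 39/40000000 ∧
      37/40000000 < t 2 ∧ t 2 < 19/20000000 ∧ 9/10000000 < t 3 ∧ t 3 < 37/40000000 := by
  have h0 := ht 0; have h1 := ht 1; have h2 := ht 2; have h3 := ht 3
  simp only [loS, hiS, mem_Ioo] at h0 h1 h2 h3
  norm_num at h0 h1 h2 h3
  exact ⟨h0.1, h0.2, h1.1, h1.2, h2.1, h2.2, h3.1, h3.2⟩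

/-- The sub-box lies in the all-low part. [folklore] -/
theorem windowS_subset_Slo : window loS hiS 4 ⊆ Slo := by
  intro t ht
  obtain ⟨a0, b0, a1, b1, a2, b2, a3, b3⟩ := mem_windowS ht
  have hδ : δ = 1 / 1000000 := δ_eq
  have hδ' : δ' = 9 / 10000000 := δ'_eq
  refine ⟨⟨⟨fun i => ?_, fun i => ?_, ?_⟩, fun i => ?_⟩, ?_⟩
  · fin_cases i <;> simp <;> linarith
  · fin_cases i <;> simp <;> linarith
  · refine Fin.strictAnti_iff_succ_lt.2 fun i => ?_
    fin_cases i <;> simp <;> linarith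
  · left
    rw [mem_Ioo, hδ, hδ']
    fin_cases i <;> simp <;> constructor <;> linarith
  · show t 0 < 1 / 2
    linarith

/-- Volume of the sub-box: `(1/4·10⁷)⁴`. [folklore] -/
theorem volume_windowS : (volume (window loS hiS 4)).toReal = (1 / 40000000 : ℝ) ^ 4 := by
  rw [window_eq_pi, Real.volume_pi_Ioo_toReal]
  · simp only [Fin.prod_univ_four, loS, hiS]
    norm_num
  · intro i
    fin_cases i <;> simp [loS, hiS] <;> norm_num

/-- **The corner invariant of the target**, as one integral of the gap. [folklore] -/
theorem windowEval_corner_target : windowEval cornerWin cFds4 = ∫ x in Sall, hgap x := by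
  rw [cFds4_eq, map_sub, windowEval_of, windowEval_of, wordRep_domain, wordRep_domain, wordRep_integrand,
    wordRep_integrand]
  change (∫ x in Sall, wordFun ω4 1 x) - ∫ x in Sall, wordFun ω31 4 x = ∫ x in Sall, hgap x
  have i4 : IntegrableOn (wordFun ω4 1) Sall volume := (integrableOn_wordFun adm_ω4 1).mono_set inter_subset_left
  have i31 : IntegrableOn (wordFun ω31 4) Sall volume :=
    (integrableOn_wordFun adm_ω31 4).mono_set inter_subset_left
  rw [← integral_sub i4 i31]
  rfl

/-- **The corner invariant of the target is positive** (`≥ 999·10¹⁵·(1/4·10⁷)⁴ − 5·10¹²·(2·10⁻⁷)⁴ > 0`).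
[folklore] -/
theorem windowEval_corner_target_pos : 0 < windowEval cornerWin cFds4 := by
  rw [windowEval_corner_target, Sall_eq_union,
    setIntegral_union disjoint_Slo_Shi measurableSet_Shi
      (integrableOn_hgap.mono_set (fun x hx => hx.1.1)) (integrableOn_hgap.mono_set (fun x hx => hx.1.1))]
  -- the all-low part
  have hlo : (999000000000000000 : ℝ) * (1 / 40000000 : ℝ) ^ 4 ≤ ∫ x in Slo, hgap x := by
    have h1 : ∫ x in window loS hiS 4, hgap x ≤ ∫ x in Slo, hgap x :=
      setIntegral_mono_set (integrableOn_hgap.mono_set (fun x hx => hx.1.1))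
        (ae_restrict_of_forall_mem measurableSet_Slo fun x hx => hgap_nonneg_of_mem_Slo hx)
        (Filter.Eventually.of_forall windowS_subset_Slo)
    have hfinW : volume (window loS hiS 4) < ⊤ := by
      rw [window_eq_pi, Real.volume_pi_Ioo]
      exact ENNReal.prod_lt_top fun _ _ => ENNReal.ofReal_lt_top
    have hconst : IntegrableOn (fun _ : Fin 4 → ℝ => (999000000000000000 : ℝ)) (window loS hiS 4) volume :=
      integrableOn_const hfinW.ne
    have h2 : ∫ _ in window loS hiS 4, (999000000000000000 : ℝ) ≤ ∫ x in window loS hiS 4, hgap x :=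
      setIntegral_mono_on hconst
        ((integrableOn_hgap.mono_set (fun x hx => hx.1.1)).mono_set windowS_subset_Slo)
        (measurableSet_window _ _ _) fun x hx => hgap_ge_of_mem_Slo (windowS_subset_Slo hx)
    rw [setIntegral_const, smul_eq_mul, measureReal_def, volume_windowS, mul_comm] at h2
    linarith
  -- the high part
  have hhi : (-5000000000000 : ℝ) * (2 * (δ - δ')) ^ 4 ≤ ∫ x in Shi, hgap x := by
    have hvol : (volume Shi).toReal ≤ (2 * (δ - δ')) ^ 4 := by
      have hle : volume Shi ≤ ENNReal.ofReal (2 * (δ - δ')) ^ 4 :=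
        (measure_mono (fun x hx => hx.1.2)).trans (volume_cornerWin_le 4)
      have hfin : ENNReal.ofReal (2 * (δ - δ')) ^ 4 ≠ ⊤ := ENNReal.pow_ne_top ENNReal.ofReal_ne_top
      have := ENNReal.toReal_mono hfin hle
      rwa [ENNReal.toReal_pow, ENNReal.toReal_ofReal (by rw [δ_eq, δ'_eq]; norm_num)] at this
    have hfin : volume Shi < ⊤ :=
      ((measure_mono (fun x hx => hx.1.2)).trans (volume_cornerWin_le 4)).trans_lt
        (ENNReal.pow_lt_top ENNReal.ofReal_lt_top)
    have hconst : IntegrableOn (fun _ : Fin 4 → ℝ => (-5000000000000 : ℝ)) Shi volume :=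
      integrableOn_const hfin.ne
    have h2 : ∫ _ in Shi, (-5000000000000 : ℝ) ≤ ∫ x in Shi, hgap x :=
      setIntegral_mono_on hconst (integrableOn_hgap.mono_set (fun x hx => hx.1.1))
        measurableSet_Shi fun x hx => hgap_ge_of_mem_Shi hx
    rw [setIntegral_const, smul_eq_mul, measureReal_def] at h2
    have h3 : (-5000000000000 : ℝ) * (2 * (δ - δ')) ^ 4 ≤ (volume Shi).toReal * (-5000000000000 : ℝ) := by
      rw [mul_comm ((volume Shi).toReal)]
      exact mul_le_mul_of_nonpos_left hvol (by norm_num)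
    linarith
  have hnum : (0 : ℝ) < 999000000000000000 * (1 / 40000000 : ℝ) ^ 4 + (-5000000000000 : ℝ) * (2 * (δ - δ')) ^ 4 := by
    rw [δ_eq, δ'_eq]; norm_num
  linarith

/-- **THE HYPEROCTAHEDRAL / CORNER-PATTERN OBSTRUCTION.** The target is not in the sub-calculus of
dissections, integrand additivity and changes of variables preserving the corner pattern `U` — in
particular not in the closure of dissections, integrand additivity, coordinate permutations and
reflections `tᵢ ↦ 1 − tᵢ` (dualities, toric flips): every move chain for `ζ(4) = 4ζ(3,1)` uses a
substitution that moves the corner pattern (such as Eie's rational map or the cubical monomial map), or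
a Newton–Leibniz move. [folklore] -/
theorem target_not_mem_invScissors_corner : cFds4 ∉ invScissors cornerWin := fun h => by
  have h0 := invScissors_le_ker_windowEval measurableSet_cornerWin h
  rw [AddMonoidHom.mem_ker] at h0
  exact windowEval_corner_target_pos.ne' h0
end Positivity

/-! ## §2 Corollary: the hyperoctahedral toolkit (permutations AND reflections) does not suffice -/

section Hyperoctahedral
/-- **Move set: change of variables by a coordinate reflection pattern** `Φ_ε` (`|det| = 1`). -/
def flipCovRel : Set FormalRep :=
  {c | ∃ (n : ℕ) (r r' : IntegralRep n) (ε : Fin n → Bool),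
    r'.domain = flipMap ε '' r.domain ∧ (∀ x ∈ r.domain, r.integrand x = r'.integrand (flipMap ε x)) ∧
    c = of r - of r'}

/-- Reflection moves preserve the corner pattern. [folklore] -/
theorem flipCovRel_subset_invCovRel : flipCovRel ⊆ invCovRel cornerWin := by
  rintro c ⟨n, r, r', ε, hdom, hint, rfl⟩
  exact ⟨n, r, r', flipMap ε, fun _ => flipLin ε, fun x _ => (hasFDerivAt_flipMap ε x).hasFDerivWithinAt,
    injOn_flipMap ε _, hdom, fun x hx => by rw [abs_det_flipLin, mul_one]; exact hint x hx,
    fun x _ => flipMap_mem_cornerWin_iff ε x, rfl⟩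

/-- Permutation moves preserve the corner pattern. [folklore] -/
theorem permCovRel_subset_invCovRel : permCovRel ⊆ invCovRel cornerWin := by
  rintro c ⟨n, r, r', σ, hdom, hint, rfl⟩
  exact ⟨n, r, r', permMap σ, fun _ => permLin σ, fun x _ => (hasFDerivAt_permMap σ x).hasFDerivWithinAt,
    (injective_permMap σ).injOn, hdom, fun x hx => by rw [abs_det_permLin, mul_one]; exact hint x hx,
    fun x _ => comp_perm_mem_cornerWin_iff σ x, rfl⟩

/-- **The hyperoctahedral-scissors sub-calculus**: dissections, integrand additivity, coordinate
permutations and reflections `tᵢ ↦ 1 − tᵢ` (it contains the shuffle toolkit, MZV duality and the toric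
flips of `ToricNormalForm.lean`). -/
def hyperScissors : AddSubgroup FormalRep :=
  AddSubgroup.closure (domainAddRel ∪ integrandAddRel ∪ permCovRel ∪ flipCovRel)

/-- Hyperoctahedral scissors is part of corner-pattern scissors. [folklore] -/
theorem hyperScissors_le_invScissors : hyperScissors ≤ invScissors cornerWin := by
  refine AddSubgroup.closure_mono ?_
  rintro c (((hc | hc) | hc) | hc)
  · exact Or.inl (Or.inl hc)
  · exact Or.inl (Or.inr hc)
  · exact Or.inr (permCovRel_subset_invCovRel hc)
  · exact Or.inr (flipCovRel_subset_invCovRel hc)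

/-- Reflection moves are changes of variables of the calculus. [folklore] -/
theorem flipCovRel_subset_changeOfVariablesRel : flipCovRel ⊆ changeOfVariablesRel := by
  rintro c ⟨n, r, r', ε, hdom, hint, rfl⟩
  have hs : IsSemialgebraicMapOn ℚ r.domain (flipMap ε) := by
    have h := isSemialgebraicMapOn_aeval r.isSemialgebraic_domain
      (fun j : Fin n => (if ε j then 1 - MvPolynomial.X j else MvPolynomial.X j : MvPolynomial (Fin n) ℚ))
    exact h.congr fun x _ => (flipMap_eq_aeval ε x).symm
  exact ⟨n, r, r', flipMap ε, fun _ => flipLin ε, hs, fun x _ => (hasFDerivAt_flipMap ε x).hasFDerivWithinAt,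
    injOn_flipMap ε _, hdom, fun x hx => by rw [abs_det_flipLin, mul_one]; exact hint x hx, rfl⟩

/-- Hyperoctahedral scissors is a genuine sub-calculus of `KZ.relations`. [folklore] -/
theorem hyperScissors_le_relations : hyperScissors ≤ relations :=
  AddSubgroup.closure_mono (by
    rintro c (((hc | hc) | hc) | hc)
    · exact Or.inl (Or.inl (Or.inl hc))
    · exact Or.inl (Or.inl (Or.inr hc))
    · exact Or.inl (Or.inr (permCovRel_subset_changeOfVariablesRel hc))
    · exact Or.inl (Or.inr (flipCovRel_subset_changeOfVariablesRel hc)))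

/-- **REFUTED STRENGTHENING: shuffles, dualities and reflections together do not prove
`ζ(4) = 4ζ(3,1)`.** Every move chain for the crux uses a change of variables outside the hyperoctahedral
group (one that moves the corner pattern, e.g. Eie's rational substitution or the cubical monomial map)
or a Newton–Leibniz move. [folklore] -/
theorem target_not_mem_hyperScissors : cFds4 ∉ hyperScissors := fun h =>
  target_not_mem_invScissors_corner (hyperScissors_le_invScissors h)
end Hyperoctahedral

end Summit.KontsevichZagierPeriods.GpcZeta4Eq4zeta31.Negative
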